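import Summits.SmoothPoincare4.SmoothPoincare4.Theses.EntropyRung
import Summits.SmoothPoincare4.SmoothPoincare4.Theorems.EntropyRungSubcylindricalExistenceAnnulusPieceFloor
import Summits.SmoothPoincare4.SmoothPoincare4.Theorems.EntropyRungSubcylindricalExistenceAnnulusModelOnM
import Summits.SmoothPoincare4.SmoothPoincare4.Theorems.EntropyRungSubcylindricalExistenceRadialCloseness
import Summits.SmoothPoincare4.SmoothPoincare4.Theorems.EntropyRungSubcylindricalExistenceCutoffFamilyZoneIntegrable
import HarnessLib

/-!
# The annulus piece, plumbed (stub `helper_annulusPiece`, piece P3 of the capping assembly)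

Helper for the crux `SubcylindricalExistence` (ENT), route `EntropyRung`, line
`fat-conical-core-avr-logsobolev`, item stmt-SmoothPoincare4-10871.

Setting. `g` is a Riemannian metric on a closed `4`-manifold `M`, Euclidean in the chart
`φ = extChartAt (𝓡 4) p` on `closedBall (φ p) r ⊆ φ.target`; the weight `Φ > 0` is radial there,
`Φ ∘ φ⁻¹ = prof(‖y − φ p‖²)`, and its log-slope `Q(s) = 2 s prof'(s)/prof(s)` is `κ₁`-close to the
exact-cone slope `−(c'+1)` on the window `s ∈ [ρ₁², ρ₂²]`, `ρ₁ = a e^{−1/2}`, `ρ₂ = b e^{1/2} < r`.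
Test functions live in the chart annulus `a < ρ < b`.

**`helper_annulusPiece`:** the weighted clause for `Φ` (potential `rG ≥ 0`, weighted Sobolev
constant `Y`) holds for such test functions at every scale at level
`3 log c' + 2 log(1−κ₀) − 8 κ₁ (log(b/a) + 1) − 2 log(1 + 24 κ₁² √(2π²(log(b/a)+1)+1)/(κ₀ Y))`.

Proof: instantiate the abstract annulus-piece floor `helper_annulusPieceFloorI` with
* `U` = the open chart annulus `ρ₁ < ρ < ρ₂` (open; the closed chart annulus `a ≤ ρ ≤ b` is the
  continuous image of a compact set, hence closed, so `tsupport v ⊆ U` for the test functions);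
* the model weight `ψ₀ = μ c' ρ^{−(c'+1)}` on `[ρ₁, ρ₂]` from `helper_annulusModelOnM`, matched to
  `Φ` at `ρ₁` (`μ = prof(ρ₁²)/(c' ρ₁^{−(c'+1)})`), with its model floor at level `3 log c'`;
* closeness `e^{∓κ}`, `κ = κ₁ log(ρ₂/ρ₁) = κ₁ (log(b/a) + 1)`, and gradient discrepancy
  `|∇ log(Φ/ψ₀)|²_g ≤ κ₁²/ρ²` from `helper_radialCloseness`;
* `ϖ = 𝟙_U ρ⁻¹`, `∫_U ϖ⁴ ≤ ∫_{ρ₁ ≤ ρ ≤ ρ₂} ρ⁻⁴ = 2π² log(ρ₂/ρ₁) ≤ 2π²(log(b/a)+1) + 1`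
  (`helper_cutoffFamily_zoneIntegral`, `helper_cutoffFamily_zoneIntegrable`).
Folklore plumbing (Perelman 2002 §3 for the `𝒲`-clause conventions).
-/

noncomputable section

open scoped Manifold ContDiff Topology ENNReal NNReal RealInnerProductSpace
set_option linter.dupNamespace false
open Set Filter Function MeasureTheory
open Literature.Geometry.Lorentzian Literature.Geometry.Riemannian

namespace Summit.SmoothPoincare4.SmoothPoincare4.Theorems

namespace HelperAnnulusPieceAux

/-! ### Scalar bookkeeping for the radii `ρ₁ = a e^{−1/2}`, `ρ₂ = b e^{1/2}` -/

/-- `log (b e^{1/2} / (a e^{−1/2})) = log (b/a) + 1` for `0 < a`, `0 < b`. [folklore] -/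
theorem log_ratio_radii {a b : ℝ} (ha : 0 < a) (hb : 0 < b) :
    Real.log (b * Real.exp (1 / 2) / (a * Real.exp (-(1 / 2)))) = Real.log (b / a) + 1 := by
  have hq : b * Real.exp (1 / 2) / (a * Real.exp (-(1 / 2))) = b / a * Real.exp 1 := by
    rw [Real.exp_neg]
    field_simp
    rw [sq, ← Real.exp_add]
    norm_num
  rw [hq, Real.log_mul (div_pos hb ha).ne' (Real.exp_pos 1).ne', Real.log_exp]

/-- `a e^{−1/2} < a` for `0 < a`. [folklore] -/
theorem radius_one_lt {a : ℝ} (ha : 0 < a) : a * Real.exp (-(1 / 2)) < a := by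
  have h : Real.exp (-(1 / 2)) < 1 := Real.exp_lt_one_iff.2 (by norm_num)
  nlinarith

/-- `b < b e^{1/2}` for `0 < b`. [folklore] -/
theorem lt_radius_two {b : ℝ} (hb : 0 < b) : b < b * Real.exp (1 / 2) := by
  have h : 1 < Real.exp (1 / 2) := Real.one_lt_exp_iff.2 (by norm_num)
  nlinarith

section Chart

variable {M : Type*} [TopologicalSpace M] [ChartedSpace (EuclideanSpace ℝ (Fin 4)) M]

/-! ### The open and closed chart annuli -/

/-- The open chart annulus `{x ∈ φ.source | ρ₁ < ‖φ x − φ p‖ < ρ₂}` is open. [folklore] -/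
theorem isOpen_annulus (p : M) (ρ₁ ρ₂ : ℝ) :
    IsOpen {x | x ∈ (extChartAt (𝓡 4) p).source ∧
      ρ₁ < ‖extChartAt (𝓡 4) p x - extChartAt (𝓡 4) p p‖ ∧
      ‖extChartAt (𝓡 4) p x - extChartAt (𝓡 4) p p‖ < ρ₂} := by
  have hset : {x | x ∈ (extChartAt (𝓡 4) p).source ∧
      ρ₁ < ‖extChartAt (𝓡 4) p x - extChartAt (𝓡 4) p p‖ ∧
      ‖extChartAt (𝓡 4) p x - extChartAt (𝓡 4) p p‖ < ρ₂} =
      (extChartAt (𝓡 4) p).source ∩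
        (fun x ↦ ‖extChartAt (𝓡 4) p x - extChartAt (𝓡 4) p p‖) ⁻¹' Ioo ρ₁ ρ₂ := rfl
  rw [hset]
  exact ((continuousOn_extChartAt p).sub continuousOn_const).norm.isOpen_inter_preimage
    (isOpen_extChartAt_source p) isOpen_Ioo

/-- For `closedBall (φ p) r ⊆ φ.target`, `b ≤ r`, `ρ₁ < a` and `b < ρ₂`, a function whose support
lies in the chart annulus `a < ρ < b` has `tsupport` in the open chart annulus `ρ₁ < ρ < ρ₂`: the
closed chart annulus `a ≤ ρ ≤ b` is the continuous image of a compact set, hence closed.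
[folklore] -/
theorem tsupport_subset_annulus [T2Space M] (p : M) {r a b ρ₁ ρ₂ : ℝ}
    (hB : Metric.closedBall (extChartAt (𝓡 4) p p) r ⊆ (extChartAt (𝓡 4) p).target)
    (hbr : b ≤ r) (h₁ : ρ₁ < a) (h₂ : b < ρ₂) {v : M → ℝ}
    (hv : ∀ x, v x ≠ 0 → x ∈ (extChartAt (𝓡 4) p).source ∧
      a < ‖extChartAt (𝓡 4) p x - extChartAt (𝓡 4) p p‖ ∧
      ‖extChartAt (𝓡 4) p x - extChartAt (𝓡 4) p p‖ < b) :
    tsupport v ⊆ {x | x ∈ (extChartAt (𝓡 4) p).source ∧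
      ρ₁ < ‖extChartAt (𝓡 4) p x - extChartAt (𝓡 4) p p‖ ∧
      ‖extChartAt (𝓡 4) p x - extChartAt (𝓡 4) p p‖ < ρ₂} := by
  set φ := extChartAt (𝓡 4) p with hφ
  set A : Set (EuclideanSpace ℝ (Fin 4)) := {y | a ≤ ‖y - φ p‖ ∧ ‖y - φ p‖ ≤ b} with hA
  have hAc : IsClosed A :=
    (isClosed_le continuous_const (continuous_id.sub continuous_const).norm).inter
      (isClosed_le (continuous_id.sub continuous_const).norm continuous_const)
  have hAt : A ⊆ φ.target := fun y hy ↦ hB (mem_closedBall_iff_norm.2 (hy.2.trans hbr))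
  have hAK : IsCompact A :=
    (isCompact_closedBall (φ p) b).of_isClosed_subset hAc fun y hy ↦ mem_closedBall_iff_norm.2 hy.2
  have hK : IsCompact (φ.symm '' A) :=
    hAK.image_of_continuousOn ((continuousOn_extChartAt_symm p).mono hAt)
  have hsupp : Function.support v ⊆ φ.symm '' A := by
    intro x hx
    obtain ⟨hxs, hxa, hxb⟩ := hv x hx
    exact ⟨φ x, ⟨hxa.le, hxb.le⟩, φ.left_inv hxs⟩
  have ht : tsupport v ⊆ φ.symm '' A := closure_minimal hsupp hK.isClosed
  intro x hx
  obtain ⟨y, ⟨hya, hyb⟩, rfl⟩ := ht hx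
  have hyt : y ∈ φ.target := hAt ⟨hya, hyb⟩
  refine ⟨φ.map_target hyt, ?_, ?_⟩
  · rw [φ.right_inv hyt]; exact h₁.trans_le hya
  · rw [φ.right_inv hyt]; exact hyb.trans_lt h₂

/-- The truncated inverse radius `ϖ = 𝟙_U ρ⁻¹` on the open chart annulus `U` (`0 ≤ ρ₁`) is
measurable: `ρ⁻¹` is continuous on the open set `U`. [folklore] -/
theorem measurable_indicator_invRadius [MeasurableSpace M] [BorelSpace M] (p : M) {ρ₁ ρ₂ : ℝ}
    (hρ₁ : 0 ≤ ρ₁) :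
    Measurable ({x | x ∈ (extChartAt (𝓡 4) p).source ∧
      ρ₁ < ‖extChartAt (𝓡 4) p x - extChartAt (𝓡 4) p p‖ ∧
      ‖extChartAt (𝓡 4) p x - extChartAt (𝓡 4) p p‖ < ρ₂}.indicator
      fun x ↦ ‖extChartAt (𝓡 4) p x - extChartAt (𝓡 4) p p‖⁻¹) := by
  classical
  rw [← Set.piecewise_eq_indicator]
  refine ContinuousOn.measurable_piecewise ?_ continuousOn_const (isOpen_annulus p ρ₁ ρ₂).measurableSet
  refine ContinuousOn.inv₀ ?_ fun x hx ↦ (hρ₁.trans_lt hx.2.1).ne'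
  exact (((continuousOn_extChartAt p).mono fun x hx ↦ hx.1).sub continuousOn_const).norm

end Chart

end HelperAnnulusPieceAux

open HelperAnnulusPieceAux in
/-- **Piece P3 (registered stub `helper_annulusPiece`) — the annulus piece floor, plumbed.**
`g` Euclidean in the chart at `p` on `closedBall _ r`; the weight `Φ` is radial there,
`Φ ∘ φ⁻¹ = prof(s)`, with log-slope `Q(s) = 2 s prof'/prof` within `κ₁` of the model slope
`−(c'+1)` on the window `[ρ₁², ρ₂²]` (`ρ₁ = a e^{−1/2}`, `ρ₂ = b e^{1/2} < r`); potential `rG ≥ 0`;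
weighted Sobolev with constant `Y`; and the Euclidean exact-cone annulus floor as hypothesis. Then
test functions living in the chart annulus `a < ρ < b` satisfy the weighted clause for `Φ` at level
`3 log c' + 2log(1−κ₀) − 8κ₁(log(b/a)+1) − 2log(1 + 24κ₁²√(2π²(log(b/a)+1)+1)/(κ₀Y))`:
`helper_annulusPieceFloorI` on the open chart annulus `ρ₁ < ρ < ρ₂` with the model weight of
`helper_annulusModelOnM` matched at `ρ₁`, closeness/discrepancy from `helper_radialCloseness`, and
the `ρ⁻⁴`-volume from `helper_cutoffFamily_zoneIntegral`. See the module docstring. -/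
theorem helper_annulusPiece :
    (∀ c' : ℝ, 0 < c' → c' ≤ 1 → ∀ ρ₁ ρ₂ : ℝ, 0 < ρ₁ → ρ₁ < ρ₂ → ∀ τ : ℝ, 0 < τ →
      ∀ v : EuclideanSpace ℝ (Fin 4) → ℝ, ContDiff ℝ ∞ v →
        tsupport v ⊆ {z | ρ₁ < ‖z‖ ∧ ‖z‖ < ρ₂} →
        ∫ z, (4 * Real.pi * τ) ^ (-(4 : ℝ) / 2) * (v z) ^ 2 * (c' * ‖z‖ ^ (-(c' + 1))) ^ 4 = 1 →
          3 * Real.log c' ≤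
            ∫ z, (4 * τ * ((c' * ‖z‖ ^ (-(c' + 1)))⁻¹ ^ 2 * ‖gradient v z‖ ^ 2)
                - (v z) ^ 2 * Real.log ((v z) ^ 2) - 4 * (v z) ^ 2)
                * ((4 * Real.pi * τ) ^ (-(4 : ℝ) / 2) * (c' * ‖z‖ ^ (-(c' + 1))) ^ 4)) →
    ∀ (M : Type) [TopologicalSpace M] [T2Space M] [SecondCountableTopology M]
      [ChartedSpace (EuclideanSpace ℝ (Fin 4)) M] [IsManifold (𝓡 4) ∞ M] [CompactSpace M]
      [T3Space M] [MeasurableSpace M] [BorelSpace M]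
      (g : PseudoRiemannianMetric (𝓡 4) ∞ (EuclideanSpace ℝ (Fin 4)) (TangentSpace (𝓡 4) : M → Type _))
      [g.HasLeviCivita] (hg : g.IsRiemannian) (p : M) (r : ℝ) (Φ rG : M → ℝ) (prof : ℝ → ℝ)
      (c' a b κ₀ κ₁ Y : ℝ),
      (Metric.closedBall (extChartAt (𝓡 4) p p) r ⊆ (extChartAt (𝓡 4) p).target ∧
        ∀ y ∈ Metric.closedBall (extChartAt (𝓡 4) p p) r, ∀ X W : EuclideanSpace ℝ (Fin 4),
          g.val ((extChartAt (𝓡 4) p).symm y)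
            (mfderiv 𝓘(ℝ, EuclideanSpace ℝ (Fin 4)) (𝓡 4) (extChartAt (𝓡 4) p).symm y X)
            (mfderiv 𝓘(ℝ, EuclideanSpace ℝ (Fin 4)) (𝓡 4) (extChartAt (𝓡 4) p).symm y W) = ⟪X, W⟫) →
      0 < r → ContDiff ℝ ∞ prof → (∀ s, 0 ≤ s → 0 < prof s) →
      ContMDiff (𝓡 4) 𝓘(ℝ, ℝ) ∞ Φ → (∀ x, 0 < Φ x) →
      (∀ y ∈ Metric.ball (extChartAt (𝓡 4) p p) r,
        Φ ((extChartAt (𝓡 4) p).symm y) = prof (‖y - extChartAt (𝓡 4) p p‖ ^ 2)) →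
      Continuous rG → (∀ x, 0 ≤ rG x) →
      0 < c' → c' ≤ 1 → 0 < a → a < b → b * Real.exp (1 / 2) < r → 0 < κ₀ → κ₀ < 1 → 0 ≤ κ₁ → 0 < Y →
      (∀ s, (a * Real.exp (-(1 / 2))) ^ 2 ≤ s → s ≤ (b * Real.exp (1 / 2)) ^ 2 →
        |2 * s * deriv prof s / prof s + (c' + 1)| ≤ κ₁) →
      (∀ u : M → ℝ, ContMDiff (𝓡 4) 𝓘(ℝ, ℝ) ∞ u →
        Y * Real.sqrt (∫ x, u x ^ 4 * Φ x ^ 4 ∂(riemannianMeasure (g.toContMDiffRiemannianMetric hg))) ≤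
          ∫ x, (6 * (Φ x ^ 2 * g.gradSq u x) + rG x * Φ x ^ 4 * u x ^ 2)
            ∂(riemannianMeasure (g.toContMDiffRiemannianMetric hg))) →
      ∀ σ : ℝ, 0 < σ → ∀ v : M → ℝ, ContMDiff (𝓡 4) 𝓘(ℝ, ℝ) ∞ v →
        (∀ x, v x ≠ 0 → x ∈ (extChartAt (𝓡 4) p).source ∧
          a < ‖extChartAt (𝓡 4) p x - extChartAt (𝓡 4) p p‖ ∧
          ‖extChartAt (𝓡 4) p x - extChartAt (𝓡 4) p p‖ < b) →
        ∫ x, (4 * Real.pi * σ) ^ (-(4 : ℝ) / 2) * (v x) ^ 2 * (Φ x) ^ 4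
            ∂(riemannianMeasure (g.toContMDiffRiemannianMetric hg)) = 1 →
          3 * Real.log c' + 2 * Real.log (1 - κ₀) - 8 * (κ₁ * (Real.log (b / a) + 1))
            - 2 * Real.log (1 + 24 * κ₁ ^ 2 * Real.sqrt (2 * Real.pi ^ 2 * (Real.log (b / a) + 1) + 1)
                / (κ₀ * Y)) ≤
            ∫ x, (σ * (rG x * (v x) ^ 2 + 4 * ((Φ x)⁻¹ ^ 2 * g.gradSq v x))
                - (v x) ^ 2 * Real.log ((v x) ^ 2) - 4 * (v x) ^ 2)
                * ((4 * Real.pi * σ) ^ (-(4 : ℝ) / 2) * (Φ x) ^ 4)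
              ∂(riemannianMeasure (g.toContMDiffRiemannianMetric hg)) := by
  intro hcone M _ _ _ _ _ _ _ _ _ g _ hg p r Φ rG prof c' a b κ₀ κ₁ Y hflat hr hprof hprofpos hΦ hΦpos
    hΦprof hrG hrG0 hc' hc'1 ha hab hbr hκ₀ hκ₀1 hκ₁ hY hslope hsob σ hσ v hv hvsupp hnorm
  set ν : Measure M := riemannianMeasure (g.toContMDiffRiemannianMetric hg) with hν
  -- the window radii `ρ₁ = a e^{-1/2}`, `ρ₂ = b e^{1/2}`
  set ρ₁ : ℝ := a * Real.exp (-(1 / 2)) with hρ₁def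
  set ρ₂ : ℝ := b * Real.exp (1 / 2) with hρ₂def
  have hb : 0 < b := ha.trans hab
  have hρ₁ : 0 < ρ₁ := mul_pos ha (Real.exp_pos _)
  have hρ₁a : ρ₁ < a := radius_one_lt ha
  have hbρ₂ : b < ρ₂ := lt_radius_two hb
  have hρ₁₂ : ρ₁ < ρ₂ := hρ₁a.trans (hab.trans hbρ₂)
  have hρ₂r : ρ₂ < r := hbr
  have hlog : Real.log (ρ₂ / ρ₁) = Real.log (b / a) + 1 := log_ratio_radii ha hb
  have hlogpos : 0 < Real.log (b / a) := Real.log_pos ((one_lt_div ha).2 hab)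
  have hL1 : 0 ≤ Real.log (b / a) + 1 := by linarith
  -- the matching constant `μ = prof(ρ₁²) / (c' ρ₁^{-(c'+1)})`
  have hΛ : 0 < c' * ρ₁ ^ (-(c' + 1)) := mul_pos hc' (Real.rpow_pos_of_pos hρ₁ _)
  set μ : ℝ := prof (ρ₁ ^ 2) / (c' * ρ₁ ^ (-(c' + 1))) with hμdef
  have hμ : 0 < μ := div_pos (hprofpos _ (sq_nonneg _)) hΛ
  have hmatch : prof (ρ₁ ^ 2) = μ * (c' * ρ₁ ^ (-(c' + 1))) := (div_mul_cancel₀ _ hΛ.ne').symm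
  -- the model weight on `M` and its floor
  obtain ⟨ψ₀, hψ₀, hψ₀pos, hψann, hfloor⟩ :=
    helper_annulusModelOnM hcone M g hg p r hflat hr c' hc' hc'1 μ ρ₁ ρ₂ hμ hρ₁ hρ₁₂ hρ₂r
  -- the region: the open chart annulus `ρ₁ < ρ < ρ₂`
  set U : Set M := {x | x ∈ (extChartAt (𝓡 4) p).source ∧
      ρ₁ < ‖extChartAt (𝓡 4) p x - extChartAt (𝓡 4) p p‖ ∧
      ‖extChartAt (𝓡 4) p x - extChartAt (𝓡 4) p p‖ < ρ₂} with hUdef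
  have hUo : IsOpen U := isOpen_annulus p ρ₁ ρ₂
  -- the model weight in chart form on the closed annulus
  have hψchart : ∀ y : EuclideanSpace ℝ (Fin 4), ρ₁ ≤ ‖y - extChartAt (𝓡 4) p p‖ →
      ‖y - extChartAt (𝓡 4) p p‖ ≤ ρ₂ →
      ψ₀ ((extChartAt (𝓡 4) p).symm y) = μ * (c' * ‖y - extChartAt (𝓡 4) p p‖ ^ (-(c' + 1))) := by
    intro y hy₁ hy₂
    have hyt : y ∈ (extChartAt (𝓡 4) p).target :=
      hflat.1 (mem_closedBall_iff_norm.2 (hy₂.trans hρ₂r.le))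
    have hys := (extChartAt (𝓡 4) p).map_target hyt
    have hyy := (extChartAt (𝓡 4) p).right_inv hyt
    rw [hψann _ hys (by rw [hyy]; exact hy₁) (by rw [hyy]; exact hy₂), hyy]
  -- closeness and gradient discrepancy on `U` (`helper_radialCloseness`, matched at `ρ₁`)
  have hclose : ∀ x ∈ U,
      g.gradSq (fun y ↦ Real.log (Φ y / ψ₀ y)) x ≤
          κ₁ ^ 2 / ‖extChartAt (𝓡 4) p x - extChartAt (𝓡 4) p p‖ ^ 2 ∧
        Real.exp (-(κ₁ * (Real.log (b / a) + 1))) ≤ Φ x / ψ₀ x ∧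
        Φ x / ψ₀ x ≤ Real.exp (κ₁ * (Real.log (b / a) + 1)) := by
    intro x hx
    have h := helper_radialCloseness M g p r Φ ψ₀ prof μ c' ρ₁ ρ₂ ρ₁ κ₁ hr hflat hprof hprofpos hμ
      hc' hρ₁ hρ₁₂ hρ₂r le_rfl hρ₁₂.le hκ₁ hΦpos hψ₀pos hΦ hψ₀ hΦprof hψchart hslope hmatch
      (extChartAt (𝓡 4) p x) hx.2.1 hx.2.2
    rw [(extChartAt (𝓡 4) p).left_inv hx.1, hlog] at h
    exact h
  -- the truncated inverse radius `ϖ = 𝟙_U ρ⁻¹`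
  set ϖ : M → ℝ := U.indicator fun x ↦ ‖extChartAt (𝓡 4) p x - extChartAt (𝓡 4) p p‖⁻¹ with hϖdef
  have hϖm : Measurable ϖ := measurable_indicator_invRadius p hρ₁.le
  have hϖ0 : ∀ x, 0 ≤ ϖ x := fun x ↦
    Set.indicator_nonneg (fun y _ ↦ inv_nonneg.2 (norm_nonneg _)) x
  have hϖU : ∀ x ∈ U, ϖ x = ‖extChartAt (𝓡 4) p x - extChartAt (𝓡 4) p p‖⁻¹ := fun x hx ↦
    Set.indicator_of_mem hx _
  have hgrad : ∀ x ∈ U, g.gradSq (fun y ↦ Real.log (Φ y / ψ₀ y)) x ≤ κ₁ ^ 2 * ϖ x ^ 2 := by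
    intro x hx
    rw [hϖU x hx, inv_pow, ← div_eq_mul_inv]
    exact (hclose x hx).1
  have hratio : ∀ x ∈ U, Real.exp (-(κ₁ * (Real.log (b / a) + 1))) ≤ Φ x / ψ₀ x ∧
      Φ x / ψ₀ x ≤ Real.exp (κ₁ * (Real.log (b / a) + 1)) := fun x hx ↦ (hclose x hx).2
  -- the `ρ⁻⁴`-volume of `U` inside the closed annulus `ρ₁ ≤ ρ ≤ ρ₂`
  set K : Set M := {x | x ∈ (extChartAt (𝓡 4) p).source ∧
      ρ₁ ≤ ‖extChartAt (𝓡 4) p x - extChartAt (𝓡 4) p p‖ ∧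
      ‖extChartAt (𝓡 4) p x - extChartAt (𝓡 4) p p‖ ≤ ρ₂} with hKdef
  have hUK : U ⊆ K := fun x hx ↦ ⟨hx.1, hx.2.1.le, hx.2.2.le⟩
  have hintK := helper_cutoffFamily_zoneIntegrable M g hg p r hflat ρ₁ ρ₂ hρ₁ hρ₂r.le
  have hvalK := helper_cutoffFamily_zoneIntegral M g hg p r hflat ρ₁ ρ₂ hρ₁ hρ₁₂.le hρ₂r.le
  rw [hlog] at hvalK
  have hϖ4 : EqOn (fun x ↦ ϖ x ^ 4)
      (fun x ↦ (‖extChartAt (𝓡 4) p x - extChartAt (𝓡 4) p p‖ ^ 4)⁻¹) U := by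
    intro x hx
    simp only [hϖU x hx, inv_pow]
  have hint : IntegrableOn (fun x ↦ ϖ x ^ 4) U ν :=
    (hintK.mono_set hUK).congr_fun hϖ4.symm hUo.measurableSet
  have hVU : ∫ x in U, ϖ x ^ 4 ∂ν ≤ 2 * Real.pi ^ 2 * (Real.log (b / a) + 1) + 1 := by
    have h1 : ∫ x in U, ϖ x ^ 4 ∂ν =
        ∫ x in U, (‖extChartAt (𝓡 4) p x - extChartAt (𝓡 4) p p‖ ^ 4)⁻¹ ∂ν :=
      setIntegral_congr_fun hUo.measurableSet hϖ4
    have h2 : ∫ x in U, (‖extChartAt (𝓡 4) p x - extChartAt (𝓡 4) p p‖ ^ 4)⁻¹ ∂ν ≤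
        ∫ x in K, (‖extChartAt (𝓡 4) p x - extChartAt (𝓡 4) p p‖ ^ 4)⁻¹ ∂ν :=
      setIntegral_mono_set hintK
        (ae_of_all _ fun x ↦ inv_nonneg.2 (pow_nonneg (norm_nonneg _) 4)) hUK.eventuallyLE
    linarith
  -- the model floor for test functions with `tsupport ⊆ U`
  have hmodel : ∀ s : ℝ, 0 < s → ∀ w : M → ℝ, ContMDiff (𝓡 4) 𝓘(ℝ, ℝ) ∞ w → tsupport w ⊆ U →
      ∫ x, (4 * Real.pi * s) ^ (-(4 : ℝ) / 2) * (w x) ^ 2 * (ψ₀ x) ^ 4 ∂ν = 1 →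
      3 * Real.log c' ≤ ∫ x, (s * (4 * ((ψ₀ x)⁻¹ ^ 2 * g.gradSq w x))
          - (w x) ^ 2 * Real.log ((w x) ^ 2) - 4 * (w x) ^ 2)
          * ((4 * Real.pi * s) ^ (-(4 : ℝ) / 2) * (ψ₀ x) ^ 4) ∂ν :=
    fun s hs w hw hsw hn ↦ hfloor s hs w hw (fun x hx ↦ hsw (subset_tsupport _ hx)) hn
  -- the test function lives in the closed annulus `a ≤ ρ ≤ b ⊆ U`
  have hsupp : tsupport v ⊆ U :=
    tsupport_subset_annulus p hflat.1 (hbρ₂.le.trans hρ₂r.le) hρ₁a hbρ₂ hvsupp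
  -- assemble with the abstract annulus-piece floor
  have hκ : 0 ≤ κ₁ * (Real.log (b / a) + 1) := mul_nonneg hκ₁ hL1
  have hV0 : 0 ≤ 2 * Real.pi ^ 2 * (Real.log (b / a) + 1) + 1 :=
    add_nonneg (mul_nonneg (by positivity) hL1) zero_le_one
  exact helper_annulusPieceFloorI M g hg U Φ ψ₀ rG ϖ (3 * Real.log c') (κ₁ * (Real.log (b / a) + 1))
    κ₀ κ₁ (2 * Real.pi ^ 2 * (Real.log (b / a) + 1) + 1) Y hΦ hψ₀ hΦpos hψ₀pos hrG hrG0 hϖm hϖ0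
    hUo.measurableSet hκ hκ₀ hκ₀1 hκ₁ hV0 hY hratio hgrad hVU hint hsob hmodel σ hσ v hv hsupp hnorm

end Summit.SmoothPoincare4.SmoothPoincare4.Theorems

end
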